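import Literature.Topology.FourManifolds.CappellShanesonGompfEquivalence
import HarnessLib

/-!
# Standard Cappell–Shaneson matrices `X_{c,d,n}` and Kim–Yamada's Corollary C mod `d`

Add-on to `CappellShanesonGompfEquivalence.lean` (Gompf equivalence `GompfEquiv`,
`GompfConjectureForTrace`, Kim–Yamada's Remark 1.1 and the reduction
`kimYamada2023_nonempty_diffeomorph_sphere_four_of_trace_mem_Icc_of` of the named fact of
`CappellShaneson.lean` to Theorem B and the three topological leaves), serving the same named fact
(M. H. Kim, S. Yamada, *Ideal classes and Cappell–Shaneson homotopy 4-spheres*, Kyungpook Math. J.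
63 (2023) 373–411, arXiv:1707.03860). That file renders Kim–Yamada's generator `∼_G` through
Gompf's row move `A ↦ Δᵏ A` on matrices in standard form and argues in prose that this agrees
with the printed Definition 2.18 on the *standard matrices* `X_{c,d,n}`. This file supplies the
printed objects and PROVES that agreement (one direction) and the remaining sentences of Cor. C:

* `standardCSMatrix c d n h` — **Def. 2.5 / Rem. 2.8 / Prop. 2.10**: for `d ∣ fₙ(c)`
  (`fₙ = csPoly n = x³ - n x² + (n - 1) x - 1`) the matrix
  `X_{c,d,n} = !![0, a, b; 0, c, d; 1, 0, n - c] ∈ SL(3, ℤ)` with `b = (c - 1)(n - c - 1)`,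
  `a d = -fₙ(c)`; proved: `det (X - 1) = 1`, `tr X = n`, Gompf standard form, `d ≠ 0`
  (`fₙ(c)` is odd), `Aₘ = X_{1,1,m+2}` and `A₀ = X_{1,1,2}` (Rem. 2.21–2.22).
* **Rem. 2.9** (proved): `E_{kc} (Δᵏ X_{c,d,n}) E_{kc}⁻¹ = X_{c,d,n+kd}` with Gompf's shear
  `E_e = gompfShear e`, hence the printed generator **`X_{c,d,n} ∼_G X_{c,d,n+kd}` is a Gompf
  equivalence** in the tree's sense (`gompfEquiv_standardCSMatrix_add_mul`, Def. 2.18).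
* **Remark 1.1, second sentence** ("`Σ^ε_{X_{c,d,n+kd}} ≅ S⁴` for any `k`") and **Cor. C, second
  and third sentences** (`fₙ(c) ≡ 0 mod d` and `n ≡ n₀ mod d` for some `-64 ≤ n₀ ≤ 69`; in
  particular `|d| ≤ 134`), relative to the same hypotheses as the reduction: Theorem B as
  `∀ n ∈ [-64, 69], GompfConjectureForTrace n` and the leaves `gompf2010_deltaMove`,
  `gompf2010_akbulutKirby_framings`, `akbulutKirby1979_sphere_four`.

No named fact is introduced (D-0026). Deliberately NOT here: Thm. 2.6 (Aitchison–Rubinstein: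
every Cappell–Shaneson matrix is similar to some `X_{c,d,n}`), Prop. 2.14 (the ideal class
`[⟨Θₙ - c, d⟩]` of `X_{c,d,n}`), Theorems A and B.

## References

* [KimYamada2023] M. H. Kim, S. Yamada, Kyungpook Math. J. 63 (2023) 373–411 (arXiv:1707.03860):
  §1.2 (Remark 1.1, Cor. C), §2.1 (Def. 2.5, Rem. 2.8, Rem. 2.9, Prop. 2.10), §2.4 (Def. 2.18,
  Rem. 2.21, Rem. 2.22).
* [GompfAGT2010] R. E. Gompf, Algebr. Geom. Topol. 10 (2010) 1665–1681, §3.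
-/

noncomputable section

open Set Polynomial
open scoped MatrixGroups Manifold ContDiff

namespace Literature.Topology.FourManifolds

universe u

/-- Local notation: `𝔼 n` is the model Euclidean space `EuclideanSpace ℝ (Fin n)`. -/
local notation "𝔼 " n:arg => EuclideanSpace ℝ (Fin n)

/-- Local notation: `𝕊 n` is the unit sphere in `EuclideanSpace ℝ (Fin (n + 1))`. -/
local notation "𝕊 " n:arg => (Metric.sphere (0 : EuclideanSpace ℝ (Fin (n + 1))) 1)

/-! ### The triples `(c, d, n)` with `d ∣ fₙ(c)` -/

section Triples

variable {c d n : ℤ}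

/-- `fₙ(c) = -c (c - 1)(n - c - 1) - 1` (Kim–Yamada 2023, proof of Prop. 2.10). [cite: KimYamada2023, Prop. 2.10 (proof)] -/
theorem eval_csPoly_eq_neg (n c : ℤ) :
    (csPoly n).eval c = -(c * (c - 1)) * (n - c - 1) - 1 := by
  rw [eval_csPoly]; ring

/-- `fₙ(c)` is odd (`c (c - 1)` is even), so non-zero: `d ∣ fₙ(c)` forces `d ≠ 0` as required of
the triples `(c, d, n) ∈ 𝒞𝒮` (Kim–Yamada 2023, §2.4). [cite: KimYamada2023, §2.4 (the set CS)] -/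
theorem odd_eval_csPoly (n c : ℤ) : Odd ((csPoly n).eval c) := by
  rw [eval_csPoly_eq_neg]
  exact ((Int.even_mul_pred_self c).neg.mul_right _).sub_odd odd_one

/-- `d ∣ fₙ(c)` implies `d ≠ 0`. [cite: KimYamada2023, §2.4 (the set CS)] -/
theorem ne_zero_of_dvd_eval_csPoly (h : d ∣ (csPoly n).eval c) : d ≠ 0 := by
  rintro rfl
  have h0 := odd_eval_csPoly n c
  rw [zero_dvd_iff.mp h] at h0
  exact (Int.not_even_iff_odd.mpr h0) (by simp)

/-- `f_{n+kd}(c) = fₙ(c) - k d c (c - 1)`: the trace move `n ↦ n + k d` preserves `d ∣ fₙ(c)`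
(Kim–Yamada 2023, Def. 2.18: `(c, d, n) ∈ 𝒞𝒮 ⇒ (c, d, n + kd) ∈ 𝒞𝒮`). [cite: KimYamada2023, Def. 2.18] -/
theorem eval_csPoly_add_mul (n k d c : ℤ) :
    (csPoly (n + k * d)).eval c = (csPoly n).eval c - d * (k * (c * (c - 1))) := by
  rw [eval_csPoly, eval_csPoly]; ring

/-- `d ∣ fₙ(c) ⇒ d ∣ f_{n+kd}(c)`. [cite: KimYamada2023, Def. 2.18] -/
theorem dvd_eval_csPoly_add_mul (h : d ∣ (csPoly n).eval c) (k : ℤ) :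
    d ∣ (csPoly (n + k * d)).eval c := by
  rw [eval_csPoly_add_mul]
  exact dvd_sub h (dvd_mul_right d _)

/-- The entry `a = -fₙ(c) / d` of `X_{c,d,n}`, determined by `a d - b c = 1` (Kim–Yamada 2023,
Rem. 2.8; proof of Prop. 2.10: "Define `a, b ∈ ℤ` by `fₙ(c) = -ad` and `b = (c-1)(n-c-1)`"). [cite: KimYamada2023, Rem. 2.8 and Prop. 2.10] -/
def csEntryA (c d n : ℤ) : ℤ := -((csPoly n).eval c / d)

/-- `a d = -fₙ(c)` when `d ∣ fₙ(c)`. [cite: KimYamada2023, Prop. 2.10 (proof)] -/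
theorem csEntryA_mul (h : d ∣ (csPoly n).eval c) : csEntryA c d n * d = -(csPoly n).eval c := by
  rw [csEntryA, neg_mul, Int.ediv_mul_cancel h]

/-- Under the trace move the entry `a` becomes `a + k c (c - 1)` (Kim–Yamada 2023, Rem. 2.9: the
`(0,1)` entry of `E (Δᵏ A) E⁻¹` is `a + c e` with `e = k c`, after `a ↦ a - k c`). [cite: KimYamada2023, Rem. 2.9] -/
theorem csEntryA_add_mul (h : d ∣ (csPoly n).eval c) (k : ℤ) :
    csEntryA c d (n + k * d) = csEntryA c d n + k * (c * (c - 1)) := by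
  rw [csEntryA, csEntryA, eval_csPoly_add_mul, Int.sub_ediv_of_dvd _ (dvd_mul_right d _),
    Int.mul_ediv_cancel_left _ (ne_zero_of_dvd_eval_csPoly h)]
  ring

end Triples

/-! ### The standard matrices `X_{c,d,n}` (Kim–Yamada 2023, Def. 2.5, Prop. 2.10) -/

section Standard

variable {c d n : ℤ}

/-- The underlying matrix `!![0, a, b; 0, c, d; 1, 0, n - c]` of `X_{c,d,n}`. [cite: KimYamada2023, Def. 2.5] -/
def standardCSMatrixVal (c d n : ℤ) : Matrix (Fin 3) (Fin 3) ℤ :=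
  !![0, csEntryA c d n, (c - 1) * (n - c - 1); 0, c, d; 1, 0, n - c]

/-- `det X_{c,d,n} = a d - b c = 1` (Kim–Yamada 2023, proof of Prop. 2.10). [cite: KimYamada2023, Prop. 2.10 (proof)] -/
theorem det_standardCSMatrixVal (h : d ∣ (csPoly n).eval c) : (standardCSMatrixVal c d n).det = 1 := by
  have hd := csEntryA_mul h
  have he := eval_csPoly n c
  simp [standardCSMatrixVal, Matrix.det_fin_three]
  linear_combination hd - he

/-- **The standard Cappell–Shaneson matrix `X_{c,d,n} ∈ SL(3, ℤ)`** of a triple with `d ∣ fₙ(c)`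
(Kim–Yamada 2023, Def. 2.5, Rem. 2.8, Prop. 2.10: the standard matrices correspond bijectively to
`𝒞𝒮 = {(c, d, n) | fₙ(c) ≡ 0 mod d, d ≠ 0}`; Gompf 2010, §3 with `e = 0`). [cite: KimYamada2023, Def. 2.5 and Prop. 2.10] -/
def standardCSMatrix (c d n : ℤ) (h : d ∣ (csPoly n).eval c) : SL(3, ℤ) :=
  ⟨standardCSMatrixVal c d n, det_standardCSMatrixVal h⟩

/-- The underlying matrix of `X_{c,d,n}`. [cite: KimYamada2023, Def. 2.5] -/
@[simp] theorem coe_standardCSMatrix (h : d ∣ (csPoly n).eval c) :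
    (standardCSMatrix c d n h : Matrix (Fin 3) (Fin 3) ℤ) =
      !![0, csEntryA c d n, (c - 1) * (n - c - 1); 0, c, d; 1, 0, n - c] := rfl

/-- `X_{c,d,n}` only depends on `(c, d, n)` (proof irrelevance in the divisibility witness). [folklore] -/
theorem standardCSMatrix_congr {n' : ℤ} (h : d ∣ (csPoly n).eval c) (h' : d ∣ (csPoly n').eval c)
    (e : n = n') : standardCSMatrix c d n h = standardCSMatrix c d n' h' := by
  subst e; rfl

/-- `X_{c,d,n}` is a Cappell–Shaneson matrix: `det (X_{c,d,n} - 1) = 1` (Kim–Yamada 2023, proof of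
Prop. 2.10: "`det (A - I) = -(c-1)(n-c-1) + (ad - b(c-1)) = 1`"). [cite: KimYamada2023, Prop. 2.10 (proof)] -/
theorem det_standardCSMatrix_sub_one (h : d ∣ (csPoly n).eval c) :
    ((standardCSMatrix c d n h : Matrix (Fin 3) (Fin 3) ℤ) - 1).det = 1 := by
  have hd := csEntryA_mul h
  have he := eval_csPoly n c
  simp [Matrix.det_fin_three, Matrix.one_fin_three]
  linear_combination hd - he

/-- `tr X_{c,d,n} = n`. [cite: KimYamada2023, Def. 2.5] -/
@[simp] theorem trace_standardCSMatrix (h : d ∣ (csPoly n).eval c) :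
    Matrix.trace (standardCSMatrix c d n h : Matrix (Fin 3) (Fin 3) ℤ) = n := by
  simp [Matrix.trace_fin_three]

/-- `X_{c,d,n}` is in Gompf's standard form (first column `e₃`, entry `e = 0`). [cite: KimYamada2023, Rem. 2.9] -/
theorem isGompfStandardForm_standardCSMatrix (h : d ∣ (csPoly n).eval c) :
    IsGompfStandardForm (standardCSMatrix c d n h) := by
  simp [IsGompfStandardForm]

/-- The entry `d` of `X_{c,d,n}`. [cite: KimYamada2023, Def. 2.5] -/
@[simp] theorem standardCSMatrix_apply_one_two (h : d ∣ (csPoly n).eval c) :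
    (standardCSMatrix c d n h : Matrix (Fin 3) (Fin 3) ℤ) 1 2 = d := rfl

/-- `fₙ(1) = -1`, so `(1, 1, n) ∈ 𝒞𝒮` for every `n`. [cite: KimYamada2023, Rem. 2.22] -/
theorem eval_csPoly_one (n : ℤ) : (csPoly n).eval 1 = -1 := by
  rw [eval_csPoly]; ring

/-- **`Aₘ = X_{1,1,m+2}`** (Kim–Yamada 2023, §1.1 and Rem. 2.22: "`X_{1,1,n+2} = Aₙ`"). [cite: KimYamada2023, Rem. 2.22] -/
theorem cappellShanesonMatrix_eq_standardCSMatrix (m : ℤ) :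
    cappellShanesonMatrix m = standardCSMatrix 1 1 (m + 2) (one_dvd _) := by
  refine Subtype.ext ?_
  have ha : csEntryA 1 1 (m + 2) = 1 := by simp [csEntryA, eval_csPoly_one]
  rw [coe_cappellShanesonMatrix, coe_standardCSMatrix, ha]
  ext i j
  fin_cases i <;> fin_cases j <;> simp [show m + 2 - 1 = m + 1 by ring]

/-- **`A₀ = X_{1,1,2}`** (Kim–Yamada 2023, Rem. 2.21: "since `A₀ = X_{1,1,2}`"). [cite: KimYamada2023, Rem. 2.21] -/
theorem akbulutKirbyMatrix_eq_standardCSMatrix :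
    akbulutKirbyMatrix = standardCSMatrix 1 1 2 (one_dvd _) := by
  rw [← cappellShanesonMatrix_zero, cappellShanesonMatrix_eq_standardCSMatrix]
  exact standardCSMatrix_congr _ _ (by norm_num)

end Standard

/-! ### Remark 2.9: the printed generator `X_{c,d,n} ∼_G X_{c,d,n+kd}` is a Gompf equivalence -/

section Move

variable {c d n : ℤ}

/-- **The row Δ-move of a standard matrix**: `Δᵏ X_{c,d,n} = !![0, a - kc, b - kd; 0, c, d;
1, kc, kd + n - c]` (Kim–Yamada 2023, Rem. 2.9, display for `ΔᵏA` with `e = 0`). [cite: KimYamada2023, Rem. 2.9] -/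
theorem coe_gompfDelta_zpow_mul_standardCSMatrix (h : d ∣ (csPoly n).eval c) (k : ℤ) :
    ((gompfDelta ^ k * standardCSMatrix c d n h : SL(3, ℤ)) : Matrix (Fin 3) (Fin 3) ℤ) =
      !![0, csEntryA c d n - k * c, (c - 1) * (n - c - 1) - k * d; 0, c, d;
        1, k * c, n - c + k * d] := by
  rw [Matrix.SpecialLinearGroup.coe_mul, coe_gompfDelta_zpow, coe_standardCSMatrix]
  ext i j
  fin_cases i <;> fin_cases j <;> simp [Matrix.mul_apply, Fin.sum_univ_three] <;> ring

/-- **Kim–Yamada 2023, Rem. 2.9 (proved): a Gompf move is a Δ-move followed by a conjugation**,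
`E_{kc} (Δᵏ X_{c,d,n}) E_{kc}⁻¹ = X_{c,d,n+kd}` with `E_e = !![1, e, 0; 0, 1, 0; 0, 0, 1]`
(`gompfShear`): "The above argument shows that the matrix `ΔᵏA` … is similar to `X_{c,d,n+kd}`". [cite: KimYamada2023, Rem. 2.9] -/
theorem gompfShear_conj_gompfDelta_zpow_mul_standardCSMatrix (h : d ∣ (csPoly n).eval c) (k : ℤ) :
    gompfShear (k * c) * (gompfDelta ^ k * standardCSMatrix c d n h) * (gompfShear (k * c))⁻¹ =
      standardCSMatrix c d (n + k * d) (dvd_eval_csPoly_add_mul h k) := by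
  refine Subtype.ext ?_
  rw [Matrix.SpecialLinearGroup.coe_mul, Matrix.SpecialLinearGroup.coe_mul,
    Matrix.SpecialLinearGroup.transvection_inv, coe_gompfShear, coe_gompfShear,
    coe_gompfDelta_zpow_mul_standardCSMatrix, coe_standardCSMatrix, csEntryA_add_mul h k]
  ext i j
  fin_cases i <;> fin_cases j <;> simp [Matrix.mul_apply, Fin.sum_univ_three] <;> ring

/-- Hence `Δᵏ X_{c,d,n}` is conjugate in `SL(3, ℤ)` to `X_{c,d,n+kd}`. [cite: KimYamada2023, Rem. 2.9] -/
theorem isConj_gompfDelta_zpow_mul_standardCSMatrix (h : d ∣ (csPoly n).eval c) (k : ℤ) :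
    IsConj (gompfDelta ^ k * standardCSMatrix c d n h)
      (standardCSMatrix c d (n + k * d) (dvd_eval_csPoly_add_mul h k)) :=
  isConj_iff.mpr ⟨gompfShear (k * c), gompfShear_conj_gompfDelta_zpow_mul_standardCSMatrix h k⟩

/-- **The printed generator `X_{c,d,n} ∼_G X_{c,d,n+kd}` of Gompf equivalence** (Kim–Yamada 2023,
Def. 2.18) **is a Gompf equivalence in the tree's rendering** `GompfEquiv` (generated by
conjugacy and the row move `A ↦ Δᵏ A`): `X_{c,d,n} ∼ Δᵏ X_{c,d,n} ∼_S X_{c,d,n+kd}` (Rem. 2.9,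
Rem. 2.17). [cite: KimYamada2023, Def. 2.18 and Rem. 2.17] -/
theorem gompfEquiv_standardCSMatrix_add_mul (h : d ∣ (csPoly n).eval c) (k : ℤ) :
    GompfEquiv (standardCSMatrix c d n h)
      (standardCSMatrix c d (n + k * d) (dvd_eval_csPoly_add_mul h k)) :=
  (GompfEquiv.gompfDelta_zpow_mul (isGompfStandardForm_standardCSMatrix h)
    (det_standardCSMatrix_sub_one h) k).trans
    (GompfEquiv.of_isConj (isConj_gompfDelta_zpow_mul_standardCSMatrix h k))

/-- **Every `Aₘ` is Gompf equivalent to `A₀` by one printed move**, `X_{1,1,m+2} ∼_G X_{1,1,2}`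
(Kim–Yamada 2023, Rem. 2.22: "Since `(1,1,n+2) ∼_G (1,1,2)`, we do not have to consider the trivial
element"; cf. `gompfEquiv_cappellShanesonMatrix_akbulutKirbyMatrix`, Gompf's Examples 3.1(a)). [cite: KimYamada2023, Rem. 2.22] -/
theorem gompfEquiv_standardCSMatrix_one_one (m : ℤ) (h : (1 : ℤ) ∣ (csPoly (m + 2)).eval 1) :
    GompfEquiv (standardCSMatrix 1 1 (m + 2) h) akbulutKirbyMatrix := by
  have h' := gompfEquiv_standardCSMatrix_add_mul h (-m)
  rwa [standardCSMatrix_congr (dvd_eval_csPoly_add_mul h (-m)) (one_dvd _)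
    (show m + 2 + -m * 1 = 2 by ring), ← akbulutKirbyMatrix_eq_standardCSMatrix] at h'

/-- **"Conjecture 2 is true for trace `n`" on the standard matrices** (Kim–Yamada 2023, Def. 2.20:
"for any integers `c` and `d` such that `(c, d, n) ∈ 𝒞𝒮`, `(c, d, n) ∼ (1, 1, 2)`"): the tree's
`GompfConjectureForTrace n` gives `X_{c,d,n} ∼ A₀ = X_{1,1,2}` for every `d ∣ fₙ(c)` (the converse,
Rem. 2.21, needs Thm. 2.6 of Aitchison–Rubinstein, not in the tree). [cite: KimYamada2023, Def. 2.20 and Rem. 2.21] -/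
theorem GompfConjectureForTrace.standardCSMatrix (hG : GompfConjectureForTrace n)
    (h : d ∣ (csPoly n).eval c) : GompfEquiv (standardCSMatrix c d n h) akbulutKirbyMatrix :=
  hG _ (det_standardCSMatrix_sub_one h) (trace_standardCSMatrix h)

/-- **Remark 1.1, second sentence, at the level of matrices**: if Gompf's conjecture holds for
trace `n₀` then `X_{c,d,n} ∼ A₀` whenever `d ∣ fₙ(c)` and `n ≡ n₀ (mod d)` — one more move
`X_{c,d,n} ∼_G X_{c,d,n₀}` (Kim–Yamada 2023, Remark 1.1: "More generally, `Σ^ε_{X_{c,d,n+kd}}` is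
diffeomorphic to `S⁴` for any `k ∈ ℤ`"; Cor. C, second sentence). [cite: KimYamada2023, Remark 1.1] -/
theorem gompfEquiv_standardCSMatrix_akbulutKirbyMatrix_of_modEq {n₀ : ℤ}
    (hG : GompfConjectureForTrace n₀) (h : d ∣ (csPoly n).eval c) (hmod : n ≡ n₀ [ZMOD d]) :
    GompfEquiv (standardCSMatrix c d n h) akbulutKirbyMatrix := by
  obtain ⟨k, hk⟩ := hmod.dvd
  have e : n + k * d = n₀ := by linear_combination -hk
  exact (gompfEquiv_standardCSMatrix_add_mul h k).trans
    (hG _ (det_standardCSMatrix_sub_one _) (by rw [trace_standardCSMatrix, e]))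

/-- **A residue window**: if `0 < |d| ≤ hi - lo + 1` then every integer is congruent mod `d` to
one in `[lo, hi]`. [folklore] -/
theorem exists_modEq_mem_Icc (n lo hi : ℤ) {d : ℤ} (hd : d ≠ 0) (hlen : |d| ≤ hi - lo + 1) :
    ∃ n₀ ∈ Icc lo hi, n ≡ n₀ [ZMOD d] := by
  refine ⟨lo + (n - lo) % d, ⟨?_, ?_⟩, ?_⟩
  · have := Int.emod_nonneg (n - lo) hd; omega
  · have := Int.emod_lt_abs (n - lo) hd; omega
  · have h1 : (n - lo) % d ≡ n - lo [ZMOD d] := Int.mod_modEq _ _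
    simpa using (h1.add_left lo).symm

end Move

/-! ### Corollary C, second and third sentences (from Theorem B and the leaves) -/

section CorollaryC

variable {c d n : ℤ} (X : Type u) [TopologicalSpace X] [T2Space X] [SecondCountableTopology X]
  [ChartedSpace (𝔼 4) X] [IsManifold (𝓡 4) ∞ X] [CompactSpace X]
  (hΔ : gompf2010_deltaMove.{u}) (h43 : gompf2010_akbulutKirby_framings.{0, 0})
  (hAK : akbulutKirby1979_sphere_four)
include hΔ h43 hAK

/-- **Kim–Yamada 2023, Remark 1.1, second sentence (relative to the leaves).** If Gompf's
conjecture is true for trace `n₀`, then every Cappell–Shaneson sphere (either framing) of every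
`X_{c,d,n}` with `n ≡ n₀ (mod d)` is diffeomorphic to `S⁴` ("`Σ^ε_{X_{c,d,n+kd}}` is diffeomorphic
to `S⁴` for any `k ∈ ℤ` and `ε ∈ ℤ₂`"), granted `gompf2010_deltaMove`,
`gompf2010_akbulutKirby_framings`, `akbulutKirby1979_sphere_four`. [cite: KimYamada2023, Remark 1.1] -/
theorem nonempty_diffeomorph_sphere_four_of_gompfConjectureForTrace_of_modEq {n₀ : ℤ}
    (hG : GompfConjectureForTrace n₀) (h : d ∣ (csPoly n).eval c) (hmod : n ≡ n₀ [ZMOD d])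
    (hX : IsCappellShanesonSphereOf (standardCSMatrix c d n h) X) :
    Nonempty (X ≃ₘ⟮𝓡 4, 𝓡 4⟯ ↥(𝕊 4)) :=
  nonempty_diffeomorph_sphere_four_of_gompfEquiv_akbulutKirbyMatrix X hΔ h43 hAK
    (gompfEquiv_standardCSMatrix_akbulutKirbyMatrix_of_modEq hG h hmod) hX

/-- **Kim–Yamada 2023, Cor. C, second sentence (from Thm. B and the leaves).** "`Σ^ε_{X_{c,d,n}}`
is diffeomorphic to `S⁴` for any `ε ∈ ℤ₂` and for any integers `c`, `d` and `n` that satisfy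
`fₙ(c) ≡ 0 mod d` and `n ≡ n₀ mod d` for some `-64 ≤ n₀ ≤ 69`", with Theorem B as the hypothesis
`∀ n ∈ [-64, 69], GompfConjectureForTrace n` (as in
`kimYamada2023_nonempty_diffeomorph_sphere_four_of_trace_mem_Icc_of`). [cite: KimYamada2023, Cor. C] -/
theorem kimYamada2023_corollaryC_of_modEq (hB : ∀ m ∈ Icc (-64 : ℤ) 69, GompfConjectureForTrace m)
    (h : d ∣ (csPoly n).eval c) {n₀ : ℤ} (hn₀ : n₀ ∈ Icc (-64 : ℤ) 69) (hmod : n ≡ n₀ [ZMOD d])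
    (hX : IsCappellShanesonSphereOf (standardCSMatrix c d n h) X) :
    Nonempty (X ≃ₘ⟮𝓡 4, 𝓡 4⟯ ↥(𝕊 4)) :=
  nonempty_diffeomorph_sphere_four_of_gompfConjectureForTrace_of_modEq X hΔ h43 hAK (hB n₀ hn₀) h
    hmod hX

/-- **Kim–Yamada 2023, Cor. C, last sentence (from Thm. B and the leaves).** "In particular,
`Σ^ε_{X_{c,d,n}}` is diffeomorphic to `S⁴` for any `ε ∈ ℤ₂` if `|d| ≤ 134`": the window
`[-64, 69]` consists of `134` consecutive integers, so `n ≡ n₀ (mod d)` for one of them. [cite: KimYamada2023, Cor. C] -/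
theorem kimYamada2023_corollaryC_of_abs_le (hB : ∀ m ∈ Icc (-64 : ℤ) 69, GompfConjectureForTrace m)
    (h : d ∣ (csPoly n).eval c) (hd : |d| ≤ 134)
    (hX : IsCappellShanesonSphereOf (standardCSMatrix c d n h) X) :
    Nonempty (X ≃ₘ⟮𝓡 4, 𝓡 4⟯ ↥(𝕊 4)) := by
  obtain ⟨n₀, hn₀, hmod⟩ :=
    exists_modEq_mem_Icc n (-64) 69 (ne_zero_of_dvd_eval_csPoly h) (by norm_num; exact hd)
  exact kimYamada2023_corollaryC_of_modEq X hΔ h43 hAK hB h hn₀ hmod hX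

end CorollaryC

end Literature.Topology.FourManifolds

end
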